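import Summits.MatrixMultiplication.MatrixMultiplication.Theses.EPRFaces
import Summits.MatrixMultiplication.MatrixMultiplication.Theorems.RectangularAlphaSplitMiddle
import Literature.Computability.AlgebraicComplexity.KroneckerRank

/-!
# `EPRFaces.ModuleGrowthRefutes` (stmt-MatrixMultiplication-10899) — proved

Route `MatrixMultiplication/EPRFaces`, support item `ModuleGrowthRefutes`:
module rank growth `∃ c > 0, n₀, ∀ n ≥ n₀, ∃ N₀, ∀ N ≥ N₀, n^{1+c}·N ≤ R(⟨n,n,N⟩)` refutes
perfect amortisation `E` (`∀ ε > 0 ∃ k ≥ 1, R(⟨n,n,n^k⟩) = O(n^{k+1+ε})`) and `ω(ℂ) = 2`.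

Proof.  The key lemma `moduleGrowthRefutes_exponent_lb`: with growth constant `c`, every `β` with
`R(⟨n,n,n^k⟩) = O(n^β)` satisfies `k + 1 + c ≤ β`.  Indeed, if `δ := k + 1 + c - β > 0`, pick `n ≥ n₀`
inside the `O`-bound (`R(⟨n,n,n^k⟩) ≤ C·n^β`) with `n^δ > C`, then `N := n^k · (N₀ + 1) ≥ N₀`; splitting
the last slot (`R(⟨n,n,M·m⟩) ≤ m·R(⟨n,n,M⟩)`, the tree's `tensorRank_matMulTensor_split_middle`
rotated by Bläser 2013 Lemma 5.5) gives `n^{1+c}·n^k·(N₀+1) ≤ (N₀+1)·C·n^β`, i.e. `n^δ ≤ C`,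
contradiction.  Then `ε := c/2` contradicts `E`, and `ω = inf admissibleExponents = 2` yields an
admissible `β < 2 + c` for `⟨n,n,n⟩ = ⟨n,n,n^1⟩`, contradicting the lemma at `k = 1`.
-/

namespace Summit.MatrixMultiplication.MatrixMultiplication.Theorems

open Filter Asymptotics
open Summit.MatrixMultiplication.MatrixMultiplication.Theses
open Literature.Computability.AlgebraicComplexity

/-- Splitting the last slot: `R(⟨n, n, M·m⟩) ≤ m · R(⟨n, n, M⟩)` — `⟨n,n,M·m⟩` is a direct sum of
`m` copies of `⟨n,n,M⟩` (Bläser 2013, §7), obtained here from the middle-slot version by the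
permutation invariance `R(⟨k,m,n⟩) = R(⟨m,n,k⟩)` (Bläser 2013, Lemma 5.5). [cite: Blaser2013, §7] -/
theorem moduleGrowthRefutes_split_last (n M m : ℕ) :
    tensorRank (matMulTensor ℂ n n (M * m)) ≤ m * tensorRank (matMulTensor ℂ n n M) := by
  rw [(Blaser2013_lemma55 ℂ n n (M * m)).2.1, (Blaser2013_lemma55 ℂ n n M).2.1]
  exact Literature.CplxAlg.tensorRank_matMulTensor_split_middle ℂ n M m

/-- Key lemma: under module rank growth with constant `c` (from `n₀` on), every real `β` with
`R(⟨n,n,n^k⟩) = O(n^β)` satisfies `k + 1 + c ≤ β`. [folklore] -/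
theorem moduleGrowthRefutes_exponent_lb {c : ℝ} {n₀ : ℕ}
    (hgrowth : ∀ n : ℕ, n₀ ≤ n → ∃ N₀ : ℕ, ∀ N : ℕ, N₀ ≤ N →
      (n : ℝ) ^ (1 + c) * (N : ℝ) ≤ (tensorRank (matMulTensor ℂ n n N) : ℝ))
    (k : ℕ) {β : ℝ}
    (hβ : (fun n : ℕ => (tensorRank (matMulTensor ℂ n n (n ^ k)) : ℝ)) =O[atTop]
      fun n : ℕ => (n : ℝ) ^ β) :
    (k : ℝ) + 1 + c ≤ β := by
  by_contra hlt
  rw [not_le] at hlt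
  set δ : ℝ := (k : ℝ) + 1 + c - β with hδ
  have hδpos : 0 < δ := by rw [hδ]; linarith
  obtain ⟨C, hC⟩ := isBigO_iff.1 hβ
  have hlim : Tendsto (fun n : ℕ => (n : ℝ) ^ δ) atTop atTop :=
    (tendsto_rpow_atTop hδpos).comp tendsto_natCast_atTop_atTop
  obtain ⟨n, hn₀, hnC, hnδ, hn1⟩ :=
    ((eventually_ge_atTop n₀).and (hC.and ((hlim.eventually_gt_atTop C).and
      (eventually_ge_atTop 1)))).exists
  have hnpos : (0 : ℝ) < n := by exact_mod_cast hn1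
  rw [Real.norm_of_nonneg (Nat.cast_nonneg _),
    Real.norm_of_nonneg (Real.rpow_nonneg hnpos.le _)] at hnC
  -- hnC : R(⟨n,n,n^k⟩) ≤ C * n^β
  obtain ⟨N₀, hN⟩ := hgrowth n hn₀
  have hnk : 1 ≤ n ^ k := Nat.one_le_pow k n hn1
  have hNle : N₀ ≤ n ^ k * (N₀ + 1) :=
    (Nat.le_succ N₀).trans (Nat.le_mul_of_pos_left (N₀ + 1) hnk)
  have h1 := hN (n ^ k * (N₀ + 1)) hNle
  -- h1 : n^(1+c) * ↑(n^k * (N₀+1)) ≤ R(⟨n,n,n^k (N₀+1)⟩)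
  have h2 : (tensorRank (matMulTensor ℂ n n (n ^ k * (N₀ + 1))) : ℝ) ≤
      ((N₀ + 1 : ℕ) : ℝ) * (tensorRank (matMulTensor ℂ n n (n ^ k)) : ℝ) := by
    exact_mod_cast moduleGrowthRefutes_split_last n (n ^ k) (N₀ + 1)
  have hm : (0 : ℝ) < ((N₀ + 1 : ℕ) : ℝ) := by exact_mod_cast Nat.succ_pos N₀
  have h3 : (n : ℝ) ^ (1 + c) * ((n : ℝ) ^ (k : ℝ)) ≤ C * (n : ℝ) ^ β := by
    have h4 : (n : ℝ) ^ (1 + c) * ((n : ℝ) ^ (k : ℝ)) * ((N₀ + 1 : ℕ) : ℝ) ≤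
        C * (n : ℝ) ^ β * ((N₀ + 1 : ℕ) : ℝ) := by
      calc (n : ℝ) ^ (1 + c) * ((n : ℝ) ^ (k : ℝ)) * ((N₀ + 1 : ℕ) : ℝ)
          = (n : ℝ) ^ (1 + c) * (((n ^ k * (N₀ + 1) : ℕ)) : ℝ) := by
            rw [Real.rpow_natCast]; push_cast; ring
        _ ≤ (tensorRank (matMulTensor ℂ n n (n ^ k * (N₀ + 1))) : ℝ) := h1
        _ ≤ ((N₀ + 1 : ℕ) : ℝ) * (tensorRank (matMulTensor ℂ n n (n ^ k)) : ℝ) := h2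
        _ ≤ ((N₀ + 1 : ℕ) : ℝ) * (C * (n : ℝ) ^ β) :=
            mul_le_mul_of_nonneg_left hnC hm.le
        _ = C * (n : ℝ) ^ β * ((N₀ + 1 : ℕ) : ℝ) := by ring
    exact le_of_mul_le_mul_right h4 hm
  -- n^(1+c) * n^k = n^δ * n^β
  have h5 : (n : ℝ) ^ (1 + c) * ((n : ℝ) ^ (k : ℝ)) = (n : ℝ) ^ δ * (n : ℝ) ^ β := by
    rw [← Real.rpow_add hnpos, ← Real.rpow_add hnpos, hδ]
    ring_nf
  rw [h5] at h3
  have h6 : (n : ℝ) ^ δ ≤ C := le_of_mul_le_mul_right h3 (Real.rpow_pos_of_pos hnpos β)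
  exact absurd h6 (not_le.2 hnδ)

/-- **`EPRFaces.ModuleGrowthRefutes`** (stmt-MatrixMultiplication-10899): module rank growth
`R(⟨n,n,N⟩) ≥ n^{1+c}·N` (for `n ≥ n₀` and `N` large) refutes perfect amortisation `E` (rank form)
and `ω(ℂ) = 2`. [folklore] -/
theorem ModuleGrowthRefutes_proof : EPRFaces.ModuleGrowthRefutes := by
  unfold EPRFaces.ModuleGrowthRefutes
  rintro ⟨c, hc, n₀, hgrowth⟩
  refine ⟨?_, ?_⟩
  · intro hE
    obtain ⟨k, -, hO⟩ := hE (c / 2) (half_pos hc)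
    have h := moduleGrowthRefutes_exponent_lb hgrowth k hO
    linarith
  · intro hMM
    rw [_root_.MatrixMultiplication_iff] at hMM
    have hlt : sInf (admissibleExponents ℂ) < 2 + c := by
      show omega ℂ < 2 + c
      rw [hMM]; linarith
    obtain ⟨β, hβ, hβlt⟩ := exists_lt_of_csInf_lt (admissibleExponents_nonempty ℂ) hlt
    have hβ0 : (fun n : ℕ => (tensorRank (matMulTensor ℂ n n n) : ℝ)) =O[atTop]
        fun n : ℕ => (n : ℝ) ^ β := hβ
    have hfun : (fun n : ℕ => (tensorRank (matMulTensor ℂ n n (n ^ 1)) : ℝ)) =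
        fun n : ℕ => (tensorRank (matMulTensor ℂ n n n) : ℝ) :=
      funext fun n => by rw [pow_one]
    have hβ' : (fun n : ℕ => (tensorRank (matMulTensor ℂ n n (n ^ 1)) : ℝ)) =O[atTop]
        fun n : ℕ => (n : ℝ) ^ β := by
      rw [hfun]; exact hβ0
    have h := moduleGrowthRefutes_exponent_lb hgrowth 1 hβ'
    push_cast at h
    linarith

end Summit.MatrixMultiplication.MatrixMultiplication.Theorems
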